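import Summits.KontsevichZagierPeriods.KontsevichZagierPeriods.Theses.AbelContraction

/-!
# Route AbelContraction — `DimensionOneGlue` (item stmt-KontsevichZagierPeriods-14404)

Pure-logic glue to the rank-0 target of route AbelContraction:
`PlanarAreas → AreasToArcs → ReductionToDimensionOne → RealArcKernel`.

Given a subgroup `R ≥ KZ.relations`, `AreasToArcs` applied to `PlanarAreas` makes every
equal-valued pair of one-dimensional representations `KZ.Equivalent`, i.e. puts `[r] − [r′]`
inside `KZ.relations ≤ R`; `ReductionToDimensionOne` then puts `ker KZ.eval` inside `R`.
The sector hypothesis of `RealArcKernel` is not consumed.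
-/

namespace Summit.KontsevichZagierPeriods.AbelContraction

/-- **DimensionOneGlue** (item stmt-KontsevichZagierPeriods-14404 of route AbelContraction):
`PlanarAreas → AreasToArcs → ReductionToDimensionOne → RealArcKernel`.
Pure logic: for `R ≥ KZ.relations`, `AreasToArcs PlanarAreas r r' hv : KZ.Equivalent r r'`
unfolds to `KZ.of r - KZ.of r' ∈ KZ.relations`, hence lies in `R`, which is exactly the
one-dimensional-pairs hypothesis of `ReductionToDimensionOne`; its conclusion is the conclusion
of `RealArcKernel` (whose sector hypothesis is discarded). -/
theorem dimensionOneGlue_proof :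
    Summit.KontsevichZagierPeriods.KontsevichZagierPeriods.Theses.AbelContraction.DimensionOneGlue := by
  unfold Summit.KontsevichZagierPeriods.KontsevichZagierPeriods.Theses.AbelContraction.DimensionOneGlue
  intro hP hT hRed R hR _ x hx
  exact hRed R hR (fun r r' hv => hR (hT hP r r' hv)) x hx

end Summit.KontsevichZagierPeriods.AbelContraction
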